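import Summits.BirchSwinnertonDyer.Rank1Residual.Additive.ChiBranchRatLowerDvdUnitRows
import Summits.BirchSwinnertonDyer.Rank1Residual.Additive.PotMultRatMainConjLowerBound
import Summits.BirchSwinnertonDyer.Rank1Residual.Additive.PotMultRatMainConjLowerBoundOdd
import Summits.BirchSwinnertonDyer.Rank1Residual.Additive.SemistableTwistAnalyticSigned
import HarnessLib

/-!
# (M) rows: the unit-coefficient certificates `Mult[Odd]BranchUnitCoeffCert` are FREE on the UNIT rows
# (index `0`) — X3♯(M) and X4(M) alike, no image hypothesis
# (cell `b2b-bsdres`, team n1011, seat n1011-p06 gen 2, OWNERS row T-N10R, phase 4, (M) unit rows)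

HONEST FRAMING (cell `b2b-bsdres`, run/shared/lean/b2b/bsd-rank1-residual/, verbatim in every
file): the goal of the cell is to DELETE the COMBINATION-SHAPED residual classes of the
Birch–Swinnerton-Dyer formula for ALL analytic-rank `≤ 1` elliptic curves over `ℚ` — "full BSD
formula for every rank `≤ 1` curve in class `C`" assembled STRICTLY from published theorems — so
that the rank-`≤ 1` remainder becomes exactly the CONSTRUCTION-SHAPED classes, which are TYPED
(missing-input `Prop`s), NOT attempted. This is not "finishing BSD". Team n1011 (X4 ∧ `p = 3` / the
additive block, §I items N10 / N11): research routes; prove what is provable now; no claim beyond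
the stated classes; X3♯(M) / X4(M) stay CONSTRUCTION-SHAPED; labels / census / located gap UNCHANGED;
nothing is booked. Theorems only (no definition, no named fact; the only Literature input is
modularity `hmod`; Pal 2012 Thm. 3.2 for `d < 0` and Gauss's sign are PROVED in the tree).

## What and why

(M) twin of census-ctyper-1's `CensusX41.unitCoeffCert_odd/even` (G-ord rows). On a UNIT row
(`L(E,1) = q·Ω_E`, `q ≠ 0`, `ord_p q = 0`) of an additive `W = C • V^{(p*)}` with `V` MULTIPLICATIVE at
`p`, the constant term of the Néron-normalised branch `ϖ · L_p^∓(f♭, a_p, ω^{(p−1)/2}, T)` of the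
multiplicative twist is `ϖ·a_p⁻¹·∑(a/p)[a/p]^∓_f` (`constantCoeff_padicLFunction{Minus,Plus}BranchMult_half`,
MTT (10.1) one-term measure, `a_p = ±1`, `p ∣ N`), and `ϖ·∑(…) = c_∞(E)·L(E,1)/Ω_E` (odd,
`entireLFunction_one_eq_of_twist_neg_signed`) resp. `= L(E,1)/Ω_E` (even, `…_of_twist_pos`) — Birch's
formula × Gauss's sign × Pal's period relation, PROVED — so it is a `p`-adic unit: the certificates
`MultOddBranchUnitCoeffCert W p` (every `p ≡ 3 (mod 4)`, `3` included) and `MultBranchUnitCoeffCert W p`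
(`p ≡ 1 (mod 4)`) of the (M) class forms (p251037 / p251406, T-O7KM, (S6)) hold with index `0` on the
unit rows. Consumers: `ChiBranchRatLowerDvdUnitRowsX3Mult.lean` (this seat) and any (M) cert-literal
end. Plus the shared bookkeeping lemma `map_C_unitsInv_mul_eq_C_mul`. Nothing booked; no label change.

References: Mazur–Tate–Teitelbaum, Invent. Math. 84 (1986) §I.10 (10.1), §I.13–I.14
[MazurTateTeitelbaum1986Invent]; A. Pal, Proc. AMS (2012) Thm. 3.2 [Pal2012]; H. Montgomery,
R. Vaughan (2007) Thm. 9.17 [MontgomeryVaughan2007].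
-/

noncomputable section

open scoped Classical MatrixGroups ModularForm NumberField

open CongruenceSubgroup WeierstrassCurve NumberField Literature.NumberTheory.EllipticCurves
  Literature.NumberTheory.EllipticCurves.ModularForms
  Literature.NumberTheory.EllipticCurves.Rank1Residual
  Literature.NumberTheory.EllipticCurves.Rank1Residual.Typed
  Literature.NumberTheory.GaloisRepresentations
  IsDedekindDomain

namespace Summit.BirchSwinnertonDyer.Rank1Residual.Additive

/-! ### §0 Bookkeeping; the (M) unit coefficient is free on the unit rows (index `0`) -/

section Cert

variable {W : WeierstrassCurve ℚ} [W.IsElliptic] [W.IsGloballyMinimal] {p : ℕ} [hp : Fact p.Prime]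

/-- Normalising a half-eigenspace element by its unit: from `ι g₁ = C(u·ϖ)·B` (`u ∈ ℤ_pˣ`) to
`ι(C(u⁻¹)·g₁) = C(ϖ)·B` (the bookkeeping step shared by every unit-row discharge of this seat). [folklore] -/
theorem map_C_unitsInv_mul_eq_C_mul {g₁ : IwasawaAlgebra p} {u : ℤ_[p]ˣ} {ϖ : ℚ}
    {B : PowerSeries ℚ_[p]}
    (h : iwasawaToPowerSeries p g₁ = PowerSeries.C (((u : ℤ_[p]) : ℚ_[p]) * (ϖ : ℚ_[p])) * B) :
    iwasawaToPowerSeries p (PowerSeries.C ((u⁻¹ : ℤ_[p]ˣ) : ℤ_[p]) * g₁) =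
      PowerSeries.C (ϖ : ℚ_[p]) * B := by
  have hCu : iwasawaToPowerSeries p (PowerSeries.C ((u⁻¹ : ℤ_[p]ˣ) : ℤ_[p])) =
      PowerSeries.C ((((u⁻¹ : ℤ_[p]ˣ) : ℤ_[p]) : ℚ_[p])) := by
    rw [PowerSeries.map_C, PadicInt.algebraMap_apply]
  have hu0 : (((u : ℤ_[p]) : ℚ_[p])) ≠ 0 := by
    intro h0
    have h1 : (((u⁻¹ : ℤ_[p]ˣ) : ℤ_[p]) : ℚ_[p]) * (((u : ℤ_[p]) : ℚ_[p])) = 1 := by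
      rw [← PadicInt.coe_mul, Units.inv_mul, PadicInt.coe_one]
    rw [h0, mul_zero] at h1
    exact zero_ne_one h1
  rw [map_mul, h, hCu, ← mul_assoc, ← map_mul, coe_units_inv_eq_inv, ← mul_assoc,
    inv_mul_cancel₀ hu0, one_mul]

/-- **(M), `p ≡ 3 (mod 4)`, UNIT rows: the constant term of `ϖ · L_p⁻(f♭, a_p, ω^{(p−1)/2}, T)` is a
`p`-adic unit** (`W = C • V^{(−p)}` additive at `p`, `V` multiplicative at `p`, `ϖ·|Ω⁻(V)| = Ω⁻_f`,
`L(E,1) = q·Ω_E`, `ord_p q = 0`: the constant term is `ϖ·ap⁻¹·S⁻`, `ap = ±1`, and `ϖ·S⁻ = c_∞(E)·q`).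
[cite: MazurTateTeitelbaum1986Invent, §I.10 (10.1), §I.13–I.14] [cite: Pal2012, Thm. 3.2]
[cite: MontgomeryVaughan2007, Thm. 9.17] -/
theorem norm_constantCoeff_minusBranchMult_eq_one_of_unitLValue
    (hmod : hasEntireLFunction_rat) (hp3 : p % 4 = 3) (hadd : Addv W p)
    (V : WeierstrassCurve ℚ) [V.IsElliptic] [V.IsGloballyMinimal] (C : VariableChange ℚ)
    (hC : C • V.quadraticTwist (-(p : ℚ)) = W) (hV : Mult V p)
    {N : ℕ} [NeZero N] {f : CuspForm (Gamma0 N) 2} (hf : IsNewformOf V f) {ap : ℤ}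
    (hap : cuspCoeff f p = ap) (ϖ : ℚ) (hϖ : (ϖ : ℝ) * V.imaginaryPeriodRat = minusPeriod f)
    {q : ℚ} (hq : W.entireLFunction 1 = (q : ℂ) * (W.realPeriodRat : ℂ)) (hq0 : q ≠ 0)
    (hv : padicValRat p q = 0) :
    ‖PowerSeries.constantCoeff
        (PowerSeries.C (ϖ : ℚ_[p]) * padicLFunctionMinusBranchMult f (ap : ℚ_[p]) (p / 2))‖ = 1 := by
  have hp2 : p ≠ 2 := by omega
  -- `a_p = ±1`, `p ∣ N`
  have hap1 : (ap = 1 ∨ ap = -1) ∧ p ∣ N := by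
    by_cases hs : V.HasSplitMultiplicativeReductionAtPrime p
    · obtain ⟨h1, -⟩ := hf.cuspCoeff_eq_one_and_sq_of_split hs
      exact ⟨Or.inl (by exact_mod_cast (hap.symm.trans h1 : ((ap : ℤ) : ℂ) = 1)),
        hf.dvd_level_of_split hs⟩
    · obtain ⟨h1, hpN⟩ := hf.cuspCoeff_eq_neg_one_and_dvd_of_nonsplit hV hs
      exact ⟨Or.inr (by exact_mod_cast (hap.symm.trans h1 : ((ap : ℤ) : ℂ) = -1)), hpN⟩
  obtain ⟨hap1, hpN⟩ := hap1
  have hap0 : (ap : ℚ_[p]) ≠ 0 := by rcases hap1 with rfl | rfl <;> norm_num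
  have hapn : ‖(ap : ℚ_[p])⁻¹‖ = 1 := by rcases hap1 with rfl | rfl <;> norm_num
  -- `L(E,1) = ϖ S⁻ Ω_E / c_∞` (sign pinned) and the unit row ⟹ `ord_p (ϖ S⁻) = 0`
  have hL := entireLFunction_one_eq_of_twist_neg_signed p hmod hp3 V W C hC (Or.inr hV) hadd hf ϖ hϖ
  set c : ℕ := (W.baseChange ℝ).numRealComponents with hc
  have hc12 : c = 1 ∨ c = 2 := by
    rw [hc, numRealComponents]
    split_ifs
    · exact Or.inr rfl
    · exact Or.inl rfl
  have hc0 : (c : ℚ) ≠ 0 := by rcases hc12 with h | h <;> rw [h] <;> norm_num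
  have hcv : padicValRat p (c : ℚ) = 0 := by
    rcases hc12 with h | h
    · rw [h, Nat.cast_one]; exact padicValRat.one
    · have h2 : padicValRat p ((2 : ℕ) : ℚ) = 0 := by
        rw [padicValRat.of_nat, Nat.cast_eq_zero]
        exact padicValNat_primes hp2
      rw [h]
      exact_mod_cast h2
  have hΩ : (W.realPeriodRat : ℂ) ≠ 0 := by exact_mod_cast W.realPeriodRat_pos_holds.ne'
  have hqS : ϖ * legendreMinusSymbolSum f p = c * q := by
    have h : ((ϖ * legendreMinusSymbolSum f p / (c : ℚ) : ℚ) : ℂ) = (q : ℂ) :=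
      mul_right_cancel₀ hΩ (hL.symm.trans hq)
    have h' : ϖ * legendreMinusSymbolSum f p / (c : ℚ) = q := by exact_mod_cast h
    rw [div_eq_iff hc0] at h'
    rw [h', mul_comm]
  have hϖS0 : ϖ * legendreMinusSymbolSum f p ≠ 0 := by rw [hqS]; exact mul_ne_zero hc0 hq0
  have hϖSv : padicValRat p (ϖ * legendreMinusSymbolSum f p) = 0 := by
    rw [hqS, padicValRat.mul hc0 hq0, hcv, hv, add_zero]
  rw [map_mul, PowerSeries.constantCoeff_C,
    constantCoeff_padicLFunctionMinusBranchMult_half p hp2 hf.1 hf.coeffField_eq_bot hpN hap hap0,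
    ← mul_assoc, mul_comm (ϖ : ℚ_[p]), mul_assoc, norm_mul, hapn, one_mul, ← Rat.cast_mul]
  exact norm_ratCast_padic_eq_one_of_padicValRat_eq_zero p hϖS0 hϖSv

/-- **(M), `p ≡ 1 (mod 4)`, UNIT rows: the constant term of `ϖ · L_p⁺(f♭, a_p, ω^{(p−1)/2}, T)` is a
`p`-adic unit** (`W = C • V^{(p)}`, `V` multiplicative at `p`, `ϖ·Ω_V = Ω⁺_f`; constant term
`ϖ·ap⁻¹·S⁺`, `constantCoeff_padicLFunctionPlusBranchMult_half`; `ϖ·S⁺ = q`, `entireLFunction_one_eq_of_twist_pos`).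
[cite: MazurTateTeitelbaum1986Invent, §I.10 (10.1), §I.13–I.14] [cite: Pal2012, Thm. 3.2]
[cite: MontgomeryVaughan2007, Thm. 9.17] -/
theorem norm_constantCoeff_plusBranchMult_eq_one_of_unitLValue
    (hmod : hasEntireLFunction_rat) (hp1 : p % 4 = 1) (hadd : Addv W p)
    (V : WeierstrassCurve ℚ) [V.IsElliptic] [V.IsGloballyMinimal] (C : VariableChange ℚ)
    (hC : C • V.quadraticTwist (p : ℚ) = W) (hV : Mult V p)
    {N : ℕ} [NeZero N] {f : CuspForm (Gamma0 N) 2} (hf : IsNewformOf V f) {ap : ℤ}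
    (hap : cuspCoeff f p = ap) (ϖ : ℚ) (hϖ : (ϖ : ℝ) * V.realPeriodRat = plusPeriod f)
    {q : ℚ} (hq : W.entireLFunction 1 = (q : ℂ) * (W.realPeriodRat : ℂ)) (hq0 : q ≠ 0)
    (hv : padicValRat p q = 0) :
    ‖PowerSeries.constantCoeff
        (PowerSeries.C (ϖ : ℚ_[p]) * padicLFunctionPlusBranchMult f (ap : ℚ_[p]) (p / 2))‖ = 1 := by
  have hp2 : p ≠ 2 := by omega
  have hap1 : (ap = 1 ∨ ap = -1) ∧ p ∣ N := by
    by_cases hs : V.HasSplitMultiplicativeReductionAtPrime p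
    · obtain ⟨h1, -⟩ := hf.cuspCoeff_eq_one_and_sq_of_split hs
      exact ⟨Or.inl (by exact_mod_cast (hap.symm.trans h1 : ((ap : ℤ) : ℂ) = 1)),
        hf.dvd_level_of_split hs⟩
    · obtain ⟨h1, hpN⟩ := hf.cuspCoeff_eq_neg_one_and_dvd_of_nonsplit hV hs
      exact ⟨Or.inr (by exact_mod_cast (hap.symm.trans h1 : ((ap : ℤ) : ℂ) = -1)), hpN⟩
  obtain ⟨hap1, hpN⟩ := hap1
  have hap0 : (ap : ℚ_[p]) ≠ 0 := by rcases hap1 with rfl | rfl <;> norm_num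
  have hapn : ‖(ap : ℚ_[p])⁻¹‖ = 1 := by rcases hap1 with rfl | rfl <;> norm_num
  have hL := entireLFunction_one_eq_of_twist_pos p hmod hp1 V W C hC (Or.inr hV) hadd hf ϖ hϖ
  have hΩ : (W.realPeriodRat : ℂ) ≠ 0 := by exact_mod_cast W.realPeriodRat_pos_holds.ne'
  have hqS : ϖ * legendrePlusSymbolSum f p = q := by
    have h : ((ϖ * legendrePlusSymbolSum f p : ℚ) : ℂ) = (q : ℂ) :=
      mul_right_cancel₀ hΩ (hL.symm.trans hq)
    exact_mod_cast h
  have hϖS0 : ϖ * legendrePlusSymbolSum f p ≠ 0 := by rw [hqS]; exact hq0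
  have hϖSv : padicValRat p (ϖ * legendrePlusSymbolSum f p) = 0 := by rw [hqS]; exact hv
  rw [map_mul, PowerSeries.constantCoeff_C,
    constantCoeff_padicLFunctionPlusBranchMult_half p hp2 hf.1 hf.coeffField_eq_bot hpN hap hap0,
    ← mul_assoc, mul_comm (ϖ : ℚ_[p]), mul_assoc, norm_mul, hapn, one_mul, ← Rat.cast_mul]
  exact norm_ratCast_padic_eq_one_of_padicValRat_eq_zero p hϖS0 hϖSv

/-- **(M), `p ≡ 3 (mod 4)` (`p = 3` included), UNIT rows: the certificate
`MultOddBranchUnitCoeffCert W p` is FREE, with index `0`** (X3♯(M) and X4(M) alike; no image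
hypothesis). [cite: MazurTateTeitelbaum1986Invent, §I.13–I.14] [cite: Pal2012, Thm. 3.2] -/
theorem multOddBranchUnitCoeffCert_of_unitLValue
    (hmod : hasEntireLFunction_rat) (hp3 : p % 4 = 3) (hadd : Addv W p)
    {q : ℚ} (hq : W.entireLFunction 1 = (q : ℂ) * (W.realPeriodRat : ℂ)) (hq0 : q ≠ 0)
    (hv : padicValRat p q = 0) :
    MultOddBranchUnitCoeffCert W p := by
  intro V _ _ C hV hC N _ f hf ap hap ϖ hϖ
  refine ⟨0, ?_⟩
  rw [PowerSeries.coeff_zero_eq_constantCoeff_apply]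
  exact norm_constantCoeff_minusBranchMult_eq_one_of_unitLValue hmod hp3 hadd V C hC hV hf hap ϖ hϖ hq
    hq0 hv

/-- **(M), `p ≡ 1 (mod 4)`, UNIT rows: the certificate `MultBranchUnitCoeffCert W p` is FREE, with
index `0`** (X3♯(M) and X4(M) alike; no image hypothesis).
[cite: MazurTateTeitelbaum1986Invent, §I.13–I.14] [cite: Pal2012, Thm. 3.2] -/
theorem multBranchUnitCoeffCert_of_unitLValue
    (hmod : hasEntireLFunction_rat) (hp1 : p % 4 = 1) (hadd : Addv W p)
    {q : ℚ} (hq : W.entireLFunction 1 = (q : ℂ) * (W.realPeriodRat : ℂ)) (hq0 : q ≠ 0)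
    (hv : padicValRat p q = 0) :
    MultBranchUnitCoeffCert W p := by
  intro V _ _ C hV hC N _ f hf ap hap ϖ hϖ
  refine ⟨0, ?_⟩
  rw [PowerSeries.coeff_zero_eq_constantCoeff_apply]
  exact norm_constantCoeff_plusBranchMult_eq_one_of_unitLValue hmod hp1 hadd V C hC hV hf hap ϖ hϖ hq
    hq0 hv

end Cert

end Summit.BirchSwinnertonDyer.Rank1Residual.Additive

end
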